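import Literature.Probability.Percolation.PercolationProofs
import Literature.Probability.Percolation.SharpnessDCTProofs
import Literature.Probability.Percolation.ProdBernoulliRusso
import Literature.Probability.LatticeModels.ProdBernoulliCoupling
import Literature.Probability.Percolation.QSMPolynomials
import Summits.CriticalPhenomena.PercolationContinuityZ3.Theorems.PercExchangeRateTransportModelFactsStubPushforward
import HarnessLib

/-!
# The finite-volume law of the label-coupled anisotropic bond family on `ℤ²×ℤ`
# (`stub_boxLaw` of line `locmod`, crux `CriticalCurveRegular`, stmt-CriticalPhenomena-16065)

Labels `U = (U_e)_{e ∈ Sym2 (ℤ³)}` are i.i.d. uniform on `[0,1]` (`labelMeasure (Site 3)`), and the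
configuration `cfg p t U` opens a lattice bond `e` iff `U_e ≤ t` (`e` vertical, `e = {x, x+e₃}`) resp.
`U_e ≤ p` (`e` horizontal). We prove the registered stub `stub_boxLaw`: for `p, t ∈ [0,1]` and every
`n`, the probability `Θ_n(p,t) = μ{cfg p t U ∈ {0 ↔ ∂Λ_n}}` is the explicit cylinder polynomial
`ProdWeight.gTheta K A par` with `K = (box 3 n).sym2` (all pairs of the box), `A = siteToBoundary 3 n`
and `par = t` on the vertical bonds of `Λ_n`, `p` on the horizontal bonds of `Λ_n`, `0` elsewhere.

Steps: (1) the push-forward of the label measure under thresholding at the level field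
`τ = t·[vertical] + p·[horizontal]` on `E = E(ℤ³)` is `prodBernoulli q`, `q = E.indicator (projIcc ∘ τ)`
(labels lie a.s. in `(0,1)`; this is the landed keystone `ModelFacts.stub_pushforward` of the sibling
crux `ModelFacts`, file `Theorems/PercExchangeRateTransportModelFactsStubPushforward.lean`, imported);
(2) `map_measureReal_apply`;
(3) the cylinder formula `RussoPath.prodBernoulli_real_eq_sum_powerset` for the event
`siteToBoundary 3 n`, determined by `K` (`DCT16.determinedBy_siteToBoundary`); (4) on `K` the
parameters agree: a pair of `K` which is a lattice bond is `{x, x+e_j}` with both ends in the box,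
vertical iff `j = 2` (`param_eq`). Sources: Grimmett, *Percolation* (1999), §1.3 (coupling) and §2.2;
Russo, Z. Wahrsch. 56 (1981), §4 Lemma 3 (cylinder decomposition).
-/

noncomputable section

open MeasureTheory Set
open Literature.Probability.Percolation Literature.Probability.LatticeModels

namespace Summit.CriticalPhenomena.PercolationContinuityZ3.Cruxes.CriticalCurveRegular.Locmod

namespace BoxLaw

/-! ## Steps 1–2: the two-level push-forward of the label measure -/

/-- The threshold map `U ↦ {e ∈ E | U_e ≤ τ_e}` is measurable (coordinatewise). -/
theorem measurable_threshold (E : Set (Sym2 (Site 3))) (τ : Sym2 (Site 3) → ℝ) :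
    Measurable (fun U : Sym2 (Site 3) → ℝ => {e | e ∈ E ∧ U e ≤ τ e}) :=
  measurable_set_iff.2 fun e => measurable_const.and
    ((show Measurable fun s : ℝ => (s ≤ τ e) from measurableSet_setOf.1 measurableSet_Iic).comp
      (measurable_pi_apply e))

/-- **Steps 1–2.** The probability that the threshold configuration lies in a measurable event `A`
is `(prodBernoulli q)(A)` with `q = E.indicator (projIcc ∘ τ)`: the label push-forward
`ModelFacts.stub_pushforward` (a.s. the labels lie in `(0,1)`, `Measure.map_congr` and the tree's
`prodBernoulli_eq_map_labels`) and `map_measureReal_apply`. -/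
theorem real_threshold_mem (E : Set (Sym2 (Site 3))) (τ : Sym2 (Site 3) → ℝ)
    {A : Set (Set (Sym2 (Site 3)))} (hA : MeasurableSet A) :
    (labelMeasure (Site 3)).real {U | {e | e ∈ E ∧ U e ≤ τ e} ∈ A} =
      (prodBernoulli (E.indicator fun e => Set.projIcc (0 : ℝ) 1 zero_le_one (τ e))).real A := by
  rw [← Summit.CriticalPhenomena.PercolationContinuityZ3.Theorems.ModelFacts.stub_pushforward E τ,
    map_measureReal_apply (measurable_threshold E τ) hA]
  rfl

/-! ## Step 4: the parameters on the pairs of the box -/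

/-- A nearest-neighbour bond `{x, x + e_j}` is an edge of `ℤ³`. -/
theorem mk_single_mem_edgeSet (x : Site 3) (j : Fin 3) :
    s(x, x + Pi.single j 1) ∈ (zdGraph 3).edgeSet :=
  (SimpleGraph.mem_edgeSet _).2 ((zdGraph_adj_iff _ _).2 ⟨j, Or.inl rfl⟩)

/-- Every edge of `ℤ³` is `{x, x + e_j}` for some site `x` and direction `j`. -/
theorem exists_eq_mk_of_mem_edgeSet {e : Sym2 (Site 3)} (he : e ∈ (zdGraph 3).edgeSet) :
    ∃ (x : Site 3) (j : Fin 3), e = s(x, x + Pi.single j 1) := by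
  induction e using Sym2.ind with
  | h a b =>
    obtain ⟨j, h | h⟩ := (zdGraph_adj_iff a b).1 ((SimpleGraph.mem_edgeSet _).1 he)
    · exact ⟨a, j, by rw [h]⟩
    · exact ⟨b, j, by rw [Sym2.eq_swap, h]⟩

/-- A vertical bond is not a bond in a direction `i` with `(eᵢ)₃ = 0`
(copied from the skeleton `Lines/locmod.lean`). -/
theorem mk_vert_ne_mk_dir (x y : Site 3) {i : Fin 3} (hi : (Pi.single i (1 : ℤ) : Site 3) 2 = 0) :
    s(x, x + Pi.single (2 : Fin 3) 1) ≠ s(y, y + Pi.single i 1) := by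
  intro h
  rw [Sym2.eq_iff] at h
  rcases h with ⟨h1, h2⟩ | ⟨h1, h2⟩
  · have a := congrFun h2 2
    have b := congrFun h1 2
    simp only [Pi.add_apply, hi, Pi.single_eq_same] at a
    omega
  · have a := congrFun h2 2
    have b := congrFun h1 2
    simp only [Pi.add_apply, hi, Pi.single_eq_same] at a b
    omega

/-- On `E`, the clamped zero-extended field is `τ` itself when `τ e ∈ [0,1]`. -/
theorem coe_indicator_projIcc_of_mem {E : Set (Sym2 (Site 3))} {τ : Sym2 (Site 3) → ℝ}
    {e : Sym2 (Site 3)} (he : e ∈ E) (h0 : 0 ≤ τ e) (h1 : τ e ≤ 1) :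
    ((E.indicator (fun e => Set.projIcc (0 : ℝ) 1 zero_le_one (τ e)) e : unitInterval) : ℝ) = τ e := by
  rw [Set.indicator_of_mem he, Set.projIcc_of_mem zero_le_one ⟨h0, h1⟩]

/-- Off `E`, the clamped zero-extended field vanishes. -/
theorem coe_indicator_projIcc_of_notMem {E : Set (Sym2 (Site 3))} {τ : Sym2 (Site 3) → ℝ}
    {e : Sym2 (Site 3)} (he : e ∉ E) :
    ((E.indicator (fun e => Set.projIcc (0 : ℝ) 1 zero_le_one (τ e)) e : unitInterval) : ℝ) = 0 := by
  rw [Set.indicator_of_notMem he]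
  rfl

/-- A horizontal bond `{x, x + e_j}` (`(e_j)₃ = 0`) of the box lies in the horizontal class `KH n`,
not in the vertical class `KV n`, and is not vertical. -/
theorem horizontal_mem {n : ℕ} {x : Site 3} {j : Fin 3} (hj : (Pi.single j (1 : ℤ) : Site 3) 2 = 0)
    (hKH : s(x, x + Pi.single j 1) ∈
      ((((box 3 n).filter fun x => x + Pi.single (0 : Fin 3) 1 ∈ box 3 n).image
          fun x => s(x, x + Pi.single (0 : Fin 3) 1)) ∪
        (((box 3 n).filter fun x => x + Pi.single (1 : Fin 3) 1 ∈ box 3 n).image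
          fun x => s(x, x + Pi.single (1 : Fin 3) 1)))) :
    (¬ ∃ y : Site 3, s(x, x + Pi.single j 1) = s(y, y + Pi.single (2 : Fin 3) 1)) ∧
      s(x, x + Pi.single j 1) ∉ (((box 3 n).filter fun x => x + Pi.single (2 : Fin 3) 1 ∈ box 3 n).image
          fun x => s(x, x + Pi.single (2 : Fin 3) 1)) ∧
      s(x, x + Pi.single j 1) ∈
        ((((box 3 n).filter fun x => x + Pi.single (0 : Fin 3) 1 ∈ box 3 n).image
            fun x => s(x, x + Pi.single (0 : Fin 3) 1)) ∪
          (((box 3 n).filter fun x => x + Pi.single (1 : Fin 3) 1 ∈ box 3 n).image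
            fun x => s(x, x + Pi.single (1 : Fin 3) 1))) := by
  have hnv : ¬ ∃ y : Site 3, s(x, x + Pi.single j 1) = s(y, y + Pi.single (2 : Fin 3) 1) :=
    fun ⟨y, hy⟩ => mk_vert_ne_mk_dir y x hj hy.symm
  refine ⟨hnv, fun h => ?_, hKH⟩
  obtain ⟨y, -, hy⟩ := Finset.mem_image.1 h
  exact hnv ⟨y, hy.symm⟩

/-- **Step 4 (parameter match).** On the pairs `K = (box 3 n).sym2` of the box, the clamped
zero-extended level field `q = E(ℤ³).indicator (projIcc ∘ τ)` (`τ = t` on vertical bonds, `p` on the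
other pairs) takes the value `t` on the vertical box bonds, `p` on the horizontal box bonds and `0` on
the non-edges. -/
theorem param_eq {n : ℕ} {p t : ℝ} (hp0 : 0 ≤ p) (hp1 : p ≤ 1) (ht0 : 0 ≤ t) (ht1 : t ≤ 1)
    (τ : Sym2 (Site 3) → ℝ)
    (hτv : ∀ e, (∃ x : Site 3, e = s(x, x + Pi.single (2 : Fin 3) 1)) → τ e = t)
    (hτh : ∀ e, ¬ (∃ x : Site 3, e = s(x, x + Pi.single (2 : Fin 3) 1)) → τ e = p)
    {i : Sym2 (Site 3)} (hi : i ∈ (box 3 n).sym2) :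
    (((zdGraph 3).edgeSet.indicator (fun e => Set.projIcc (0 : ℝ) 1 zero_le_one (τ e)) i :
        unitInterval) : ℝ) =
      (if i ∈ (((box 3 n).filter fun x => x + Pi.single (2 : Fin 3) 1 ∈ box 3 n).image
          fun x => s(x, x + Pi.single (2 : Fin 3) 1)) then t
      else if i ∈ ((((box 3 n).filter fun x => x + Pi.single (0 : Fin 3) 1 ∈ box 3 n).image
          fun x => s(x, x + Pi.single (0 : Fin 3) 1)) ∪
          (((box 3 n).filter fun x => x + Pi.single (1 : Fin 3) 1 ∈ box 3 n).image
          fun x => s(x, x + Pi.single (1 : Fin 3) 1))) then p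
      else 0) := by
  by_cases he : i ∈ (zdGraph 3).edgeSet
  · obtain ⟨x, j, rfl⟩ := exists_eq_mk_of_mem_edgeSet he
    obtain ⟨hx, hxj⟩ := Finset.mk_mem_sym2_iff.1 hi
    have hj : ∀ j : Fin 3, j = 0 ∨ j = 1 ∨ j = 2 := by decide
    rcases hj j with rfl | rfl | rfl
    · -- a horizontal bond in the direction `e₁`
      obtain ⟨hnv, hKV, hKH⟩ := horizontal_mem (n := n) (x := x) (j := 0) (by simp)
        (Finset.mem_union_left _ (Finset.mem_image.2 ⟨x, Finset.mem_filter.2 ⟨hx, hxj⟩, rfl⟩))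
      have hτ : τ s(x, x + Pi.single (0 : Fin 3) 1) = p := hτh _ (fun ⟨y, hy⟩ => hnv ⟨y, hy⟩)
      rw [coe_indicator_projIcc_of_mem he (hτ ▸ hp0) (hτ ▸ hp1), hτ, if_neg hKV, if_pos hKH]
    · -- a horizontal bond in the direction `e₂`
      obtain ⟨hnv, hKV, hKH⟩ := horizontal_mem (n := n) (x := x) (j := 1) (by simp)
        (Finset.mem_union_right _ (Finset.mem_image.2 ⟨x, Finset.mem_filter.2 ⟨hx, hxj⟩, rfl⟩))
      have hτ : τ s(x, x + Pi.single (1 : Fin 3) 1) = p := hτh _ (fun ⟨y, hy⟩ => hnv ⟨y, hy⟩)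
      rw [coe_indicator_projIcc_of_mem he (hτ ▸ hp0) (hτ ▸ hp1), hτ, if_neg hKV, if_pos hKH]
    · -- a vertical bond
      have hKV : s(x, x + Pi.single (2 : Fin 3) 1) ∈
          (((box 3 n).filter fun x => x + Pi.single (2 : Fin 3) 1 ∈ box 3 n).image
            fun x => s(x, x + Pi.single (2 : Fin 3) 1)) :=
        Finset.mem_image.2 ⟨x, Finset.mem_filter.2 ⟨hx, hxj⟩, rfl⟩
      have hτ : τ s(x, x + Pi.single (2 : Fin 3) 1) = t := hτv _ ⟨x, rfl⟩
      rw [coe_indicator_projIcc_of_mem he (hτ ▸ ht0) (hτ ▸ ht1), hτ, if_pos hKV]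
  · -- a non-edge: parameter `0` on both sides
    have hKV : i ∉ (((box 3 n).filter fun x => x + Pi.single (2 : Fin 3) 1 ∈ box 3 n).image
        fun x => s(x, x + Pi.single (2 : Fin 3) 1)) := by
      intro h
      obtain ⟨y, -, rfl⟩ := Finset.mem_image.1 h
      exact he (mk_single_mem_edgeSet y 2)
    have hKH : i ∉ ((((box 3 n).filter fun x => x + Pi.single (0 : Fin 3) 1 ∈ box 3 n).image
          fun x => s(x, x + Pi.single (0 : Fin 3) 1)) ∪
        (((box 3 n).filter fun x => x + Pi.single (1 : Fin 3) 1 ∈ box 3 n).image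
          fun x => s(x, x + Pi.single (1 : Fin 3) 1))) := by
      intro h
      rcases Finset.mem_union.1 h with h | h
      · obtain ⟨y, -, rfl⟩ := Finset.mem_image.1 h
        exact he (mk_single_mem_edgeSet y 0)
      · obtain ⟨y, -, rfl⟩ := Finset.mem_image.1 h
        exact he (mk_single_mem_edgeSet y 1)
    rw [coe_indicator_projIcc_of_notMem he, if_neg hKV, if_neg hKH]

/-- The two-level configuration `cfg p t U` of the crux is the threshold configuration at the level
field `τ` (`= t` on vertical bonds, `= p` elsewhere) on `E(ℤ³)`. -/
theorem cfg_eq (p t : ℝ) (τ : Sym2 (Site 3) → ℝ)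
    (hτv : ∀ e, (∃ x : Site 3, e = s(x, x + Pi.single (2 : Fin 3) 1)) → τ e = t)
    (hτh : ∀ e, ¬ (∃ x : Site 3, e = s(x, x + Pi.single (2 : Fin 3) 1)) → τ e = p)
    (U : Sym2 (Site 3) → ℝ) :
    {e | e ∈ (zdGraph 3).edgeSet ∧
        (((∃ x : Site 3, e = s(x, x + Pi.single (2 : Fin 3) 1)) ∧ U e ≤ t) ∨
          (¬ (∃ x : Site 3, e = s(x, x + Pi.single (2 : Fin 3) 1)) ∧ U e ≤ p))} =
      {e | e ∈ (zdGraph 3).edgeSet ∧ U e ≤ τ e} := by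
  ext e
  simp only [Set.mem_setOf_eq]
  by_cases hv : ∃ x : Site 3, e = s(x, x + Pi.single (2 : Fin 3) 1)
  · rw [hτv e hv]
    exact ⟨fun ⟨h1, h2⟩ => ⟨h1, h2.elim (fun h => h.2) (fun h => absurd hv h.1)⟩,
      fun ⟨h1, h2⟩ => ⟨h1, Or.inl ⟨hv, h2⟩⟩⟩
  · rw [hτh e hv]
    exact ⟨fun ⟨h1, h2⟩ => ⟨h1, h2.elim (fun h => absurd h.1 hv) (fun h => h.2)⟩,
      fun ⟨h1, h2⟩ => ⟨h1, Or.inr ⟨hv, h2⟩⟩⟩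

end BoxLaw

/-- **stub 4 (registered) `stub_boxLaw` of line `locmod` — the two-parameter finite-volume law.**
For `p, t ∈ [0,1]` and every `n`, the `labelMeasure`-probability that the two-level configuration
(`z`-bonds open iff `U_e ≤ t`, `x`/`y`-bonds iff `U_e ≤ p`) joins `0` to `∂Λ_n` inside `Λ_n` equals
the cylinder polynomial `ProdWeight.gTheta ((box 3 n).sym2) (siteToBoundary 3 n) par` with `par = t` on
the vertical box bonds, `p` on the horizontal box bonds and `0` on the other pairs. -/
theorem stub_boxLaw :
    ∀ n : ℕ, ∀ p t : ℝ, 0 ≤ p → p ≤ 1 → 0 ≤ t → t ≤ 1 →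
      (labelMeasure (Site 3)).real {U |
        {e | e ∈ (zdGraph 3).edgeSet ∧
            (((∃ x : Site 3, e = s(x, x + Pi.single (2 : Fin 3) 1)) ∧ U e ≤ t) ∨
              (¬ (∃ x : Site 3, e = s(x, x + Pi.single (2 : Fin 3) 1)) ∧ U e ≤ p))} ∈
          siteToBoundary 3 n} =
      ProdWeight.gTheta ((box 3 n).sym2) (siteToBoundary 3 n) (fun e =>
        if e ∈ (((box 3 n).filter fun x => x + Pi.single (2 : Fin 3) 1 ∈ box 3 n).image
            fun x => s(x, x + Pi.single (2 : Fin 3) 1)) then t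
        else if e ∈ ((((box 3 n).filter fun x => x + Pi.single (0 : Fin 3) 1 ∈ box 3 n).image
            fun x => s(x, x + Pi.single (0 : Fin 3) 1)) ∪
            (((box 3 n).filter fun x => x + Pi.single (1 : Fin 3) 1 ∈ box 3 n).image
            fun x => s(x, x + Pi.single (1 : Fin 3) 1))) then p
        else 0) := by
  intro n p t hp0 hp1 ht0 ht1
  classical
  -- the level field `τ = t` on vertical bonds, `p` elsewhere
  obtain ⟨τ, hτ⟩ : ∃ τ : Sym2 (Site 3) → ℝ,
      ∀ e, τ e = if (∃ x : Site 3, e = s(x, x + Pi.single (2 : Fin 3) 1)) then t else p :=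
    ⟨fun e => if (∃ x : Site 3, e = s(x, x + Pi.single (2 : Fin 3) 1)) then t else p, fun _ => rfl⟩
  have hτv : ∀ e, (∃ x : Site 3, e = s(x, x + Pi.single (2 : Fin 3) 1)) → τ e = t :=
    fun e h => by rw [hτ e, if_pos h]
  have hτh : ∀ e, ¬ (∃ x : Site 3, e = s(x, x + Pi.single (2 : Fin 3) 1)) → τ e = p :=
    fun e h => by rw [hτ e, if_neg h]
  -- steps 1–3: push-forward, `map_measureReal_apply`, cylinder decomposition
  simp_rw [BoxLaw.cfg_eq p t τ hτv hτh]
  rw [BoxLaw.real_threshold_mem _ τ (DCT16.measurableSet_siteToBoundary 3 n),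
    RussoPath.prodBernoulli_real_eq_sum_powerset (DCT16.determinedBy_siteToBoundary 3 n)]
  -- step 4: termwise comparison with `gTheta`
  unfold ProdWeight.gTheta
  refine Finset.sum_congr rfl fun S _ => ?_
  split_ifs
  · unfold ProdWeight.gW ProdWeight.gwt
    refine Finset.prod_congr rfl fun i hi => ?_
    rw [BoxLaw.param_eq hp0 hp1 ht0 ht1 τ hτv hτh hi]
    beta_reduce
    split_ifs <;> rfl
  · rfl

end Summit.CriticalPhenomena.PercolationContinuityZ3.Cruxes.CriticalCurveRegular.Locmod

end
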